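import Summits.ResolutionOfSingularities.ResolutionOfSingularities.Theorems.UniversalCellsCampaignW82DifferentialCriterionScheme
import Summits.ResolutionOfSingularities.ResolutionOfSingularities.Theorems.UniversalCellsCampaignW82DifferentialCriterionSeparating
import HarnessLib

/-!
# [OURS · L1 W8.2] THE 1-FORM CRITERION FOR SCHEMES over a separably generated ground field: `q : Y ⟶ Spec K` is
# smooth iff `Y` is regular and `dx_1 ∧ … ∧ dx_r` vanishes nowhere (`x` a separating transcendence basis of `K/k`,
# `k` perfect)

Cell `res-hironaka` (run/shared/lean/pub/res-hironaka/), LADDER-RESOLUTION rung L (RESCUE), slot W8.2; host route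
`UniversalCells`, host item `PrimeFieldToPerfect` (stmt-ResolutionOfSingularities-15233), door 1. Proofs file
(Theses-free), written by res-L1-s82-pv-1 (gen 7): scheme form of `…DifferentialCriterionSeparating` (form (E6) of
Cruxes/PrimeFieldToPerfect/KERNEL.md §2 at any `p`-rank), over the stalk lemmas of `…DifferentialCriterionScheme`.

* `mem_smoothLocus_iff_linearIndependent_D` — `k` PERFECT, `K` essentially of finite type over `k` with a finite
  separating transcendence basis `x` (for `K` finitely generated over `𝔽_p`: a `p`-basis), `q : Y ⟶ Spec K` locally of
  finite presentation, `𝒪_{Y,y}` regular: `y ∈ sm(q)` iff the 1-forms `d(x_i)` are linearly independent in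
  `κ(y) ⊗ Ω_{𝒪_{Y,y}/k}`.
* **`smooth_iff_isRegular_and_forall_linearIndependent_D`** — `q` is smooth iff `Y` is regular and this holds at
  every `y ∈ Y` («`dx_1 ∧ … ∧ dx_r` vanishes nowhere on `Y`»).

The crux link (`primeFieldToPerfect_of_oneFormTwist`) is the cone leaf `…DifferentialCriterionKernelLinks`.

HONEST FRAMING. OURS theorems (classical; EGA 0_IV 20.5.7, Springer 4.2.9, Stacks 00TV/056S); NOT statements of
[Hironaka2017]; nothing attributed to its author. A normal form, not progress on the open residual. AI work, weaker
than expert review; no claim beyond the kernel. No `sorry`, no new axioms.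
-/

noncomputable section

set_option linter.dupNamespace false -- mandated namespace of this single-conjunct summit

open CategoryTheory CategoryTheory.Limits AlgebraicGeometry TopologicalSpace TensorProduct IsLocalRing
open Literature.AlgebraicGeometry.Resolution

namespace Summit.ResolutionOfSingularities.ResolutionOfSingularities.Theorems.CampaignW82

universe u

/-! ## The 1-form criterion for schemes over a separably generated ground field -/

section Separating

variable {k K : Type u} [Field k] [PerfectField k] [Field K] [Algebra k K] [Algebra.EssFiniteType k K]
  {ι : Type*} [Fintype ι] {x : ι → K}
  {Y : Scheme.{u}} (q : Y ⟶ Spec (.of K))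

/-- **Pointwise**: `k` perfect, `x` a finite separating transcendence basis of `K/k`, `q : Y ⟶ Spec K` locally of
finite presentation, `𝒪_{Y,y}` regular: `y ∈ sm(q)` iff the `d(x_i)` are linearly independent in
`κ(y) ⊗ Ω_{𝒪_{Y,y}/k}`. [cite: EGA0IV, Thm. 20.5.7] -/
theorem mem_smoothLocus_iff_linearIndependent_D (hx : AlgebraicIndependent k x)
    [Algebra.IsSeparable (IntermediateField.adjoin k (Set.range x)) K] [LocallyOfFinitePresentation q] (y : Y)
    [IsRegularLocalRing (Y.presheaf.stalk y)] :
    letI φ := ((Scheme.ΓSpecIso (.of K)).inv ≫ q.appTop ≫ Y.presheaf.germ ⊤ y trivial).hom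
    letI : Algebra K (Y.presheaf.stalk y) := φ.toAlgebra
    letI : Algebra k (Y.presheaf.stalk y) := (φ.comp (algebraMap k K)).toAlgebra
    y ∈ q.smoothLocus ↔
      LinearIndependent (ResidueField (Y.presheaf.stalk y))
        (fun i => (1 : ResidueField (Y.presheaf.stalk y)) ⊗ₜ[Y.presheaf.stalk y]
          KaehlerDifferential.D k (Y.presheaf.stalk y) (φ (x i))) := by
  letI φ := ((Scheme.ΓSpecIso (.of K)).inv ≫ q.appTop ≫ Y.presheaf.germ ⊤ y trivial).hom
  letI : Algebra K (Y.presheaf.stalk y) := φ.toAlgebra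
  letI : Algebra k (Y.presheaf.stalk y) := (φ.comp (algebraMap k K)).toAlgebra
  haveI : IsScalarTower k K (Y.presheaf.stalk y) := IsScalarTower.of_algebraMap_eq' rfl
  haveI : Algebra.EssFiniteType K (Y.presheaf.stalk y) := essFiniteType_stalk q y
  haveI : Algebra.EssFiniteType k (Y.presheaf.stalk y) := Algebra.EssFiniteType.comp k K (Y.presheaf.stalk y)
  rw [mem_smoothLocus_iff_formallySmooth_stalk q y]
  exact formallySmooth_iff_linearIndependent_D_of_isRegularLocalRing k K (Y.presheaf.stalk y) hx

/-- **Global — «`dx_1 ∧ … ∧ dx_r` vanishes nowhere»**: `k` perfect, `x` a finite separating transcendence basis of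
`K/k`, `q : Y ⟶ Spec K` locally of finite presentation: `q` is smooth iff `Y` is a regular scheme and at every
`y ∈ Y` the `d(x_i)` are linearly independent in `κ(y) ⊗ Ω_{𝒪_{Y,y}/k}`. [cite: EGA0IV, Thm. 20.5.7] -/
theorem smooth_iff_isRegular_and_forall_linearIndependent_D (hx : AlgebraicIndependent k x)
    [Algebra.IsSeparable (IntermediateField.adjoin k (Set.range x)) K] [LocallyOfFinitePresentation q] :
    Smooth q ↔
      Scheme.IsRegular Y ∧
        ∀ y : Y,
          letI φ := ((Scheme.ΓSpecIso (.of K)).inv ≫ q.appTop ≫ Y.presheaf.germ ⊤ y trivial).hom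
          letI : Algebra K (Y.presheaf.stalk y) := φ.toAlgebra
          letI : Algebra k (Y.presheaf.stalk y) := (φ.comp (algebraMap k K)).toAlgebra
          LinearIndependent (ResidueField (Y.presheaf.stalk y))
            (fun i => (1 : ResidueField (Y.presheaf.stalk y)) ⊗ₜ[Y.presheaf.stalk y]
              KaehlerDifferential.D k (Y.presheaf.stalk y) (φ (x i))) := by
  constructor
  · intro hq
    have hreg : Scheme.IsRegular Y := fun y => isRegularLocalRing_stalk_of_smooth_of_field q y
    refine ⟨hreg, fun y => ?_⟩
    haveI := hreg y
    have hy : y ∈ q.smoothLocus := by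
      rw [Scheme.Hom.smoothLocus_eq_top]
      trivial
    exact (mem_smoothLocus_iff_linearIndependent_D q hx y).mp hy
  · rintro ⟨hreg, h⟩
    rw [← Scheme.Hom.smoothLocus_eq_top_iff, ← top_le_iff]
    intro y _
    haveI := hreg y
    exact (mem_smoothLocus_iff_linearIndependent_D q hx y).mpr (h y)

end Separating

end Summit.ResolutionOfSingularities.ResolutionOfSingularities.Theorems.CampaignW82
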